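import Summits.AtomisticToContinuum.HydrodynamicLimit.Theorems.CollisionIsometryCLTDiffuseBackwardInfluenceDefs

/-!
# `DiffuseBackwardInfluence`, line `share-nondegeneracy-one-flight`: the late-merge stub reduced to ONE named
two-body estimate — late host–host CONTACTS of the two influence tracers are rare
(stub `stub_lateMergesRare` of crux stmt-AtomisticToContinuum-12950; support file, registered sub-goal
`lateMergesRare_of_lateTouchRare`)

The registered stub `stub_lateMergesRare` (`∀ profiles, ∃ σ₀, ∀ σ < σ₀, ∀ Φ, LateMergesRareAt σ a₀ θ₀ u₀ Φ`) is an
OPEN positive-density two-body statement (no proof in tree or print). This file does three things.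

1. **Formal sanity of the statement** (`§1`): the realised unit normal has norm `≤ 1`
   (`norm_unitNormal_le_one`), hence by Bessel/Cauchy–Schwarz `blockShare ≤ blockMass`
   (`blockShare_le_blockMass`) and the handed-over fractions lie in `[0, 1]` (`shareFrac_nonneg`,
   `shareFrac_le_one`); consequently the two-tracer merge mass is nonnegative (`mergeAt_nonneg`,
   `lateMergeFr_nonneg`) — the integrand `ENNReal.ofReal (lateMergeFr …)` of the stub loses nothing — and it is
   dominated by the CONTACT mass (`mergeAt_le_touchAt`): `mergeAt src k = touchAt src k · (f_p(1−f_q) + f_q(1−f_p))`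
   with `f_p(1−f_q) + f_q(1−f_p) ∈ [0, 1]`.
2. **The kinship dictionary** (`§2`): `touchAt src k := 2 (a_{p,src}(k)/3)(a_{q,src}(k)/3)` at the reflected pair
   `(p, q)` of fold step `k` is, in the exact tracer duality (`μ_src(i) = a_{i,src}/3` = law of ONE influence tracer
   of source `src`), the probability that the two conditionally independent tracers of `src` sit on the two endpoints
   of collision `k` just before it (a host–host CONTACT of the two tracers); summed over the sources it is
   `(2/9) K_{pq}(k)` with the KINSHIP `K_{pq}(n) := Σ_src a_{p,src}(n) a_{q,src}(n)` (`sum_touchAt_eq_kinship`), and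
   under the row budget `RowBudgetN σ` (neighbour stub, taken here only as an explicit hypothesis) `K_{pq} ≤ 9`, so a
   single fold step carries total contact mass `≤ 2` (`kinship_le_nine`, `sum_touchAt_le_two`): the late contact
   mass `lateTouchFr` is `≤ 2 · #(late fold steps)/(N+1) ≍ n_N/L`, neither trivially small nor bounded.
3. **The reduction** (`§3`): `lateMergeFr ≤ lateTouchFr` pointwise (`lateMergeFr_le_lateTouchFr`), whence the
   registered sub-goal `lateMergesRare_of_lateTouchRare : LateTouchRareAt ⇒ LateMergesRareAt` (monotonicity of the
   outer integral) and `lateMergesRareAll_of_lateTouchRare : LateTouchRare ⇒` the stub's statement verbatim.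

THE NAMED TWO-BODY ESTIMATE the stub is blocked on is `LateMerges.LateTouchRare`
(`∀ profiles, ∃ σ₀ > 0, ∀ σ ∈ (0, σ₀), ∀ Φ, LateMerges.LateTouchRareAt σ a₀ θ₀ u₀ Φ`), with
`LateTouchRareAt` = `LateMergesRareAt` with `lateMergeFr` replaced by `lateTouchFr`: along the local-Gibbs-EVOLVED
law, for every admissible window, `t > 0` and `ε > 0` there is `L ≥ 1` such that eventually the expected number of
host–host contacts of the two tracers of a uniform source during the last `1/L` of the window is `≤ ε`. It is the
`LateTouch(R) → 0` input of the idea card `coalescing-influence-tracers` (pair transience in `d = 3`: after parting,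
prompt re-touches have multiplicity `r(σ) = O(σ³)`, late ones intensity `≍ σ⁶ j^{−3/2}` at lag `j` free times,
summable; named collective failure = CONFINEMENT of both tracers to `O(1)` hosts, kill criterion k3 of the route).
It is free of shares and normals: a statement about block MASSES (tracer laws) at colliding pairs only.

CAVEAT on the content of the named estimate (for the line's bookkeeping, not used below): a late `η`-non-degenerate
split of the two tracers at a `(p, q)`-contact `k` followed by a PROMPT re-touch `k'` of the same pair contributes
`touchAt src k' = 2 μ_{k+1}(p) μ_{k+1}(q) ≥ 2η² μ_k(p)²` (exchange rule: `μ_{k+1}(p) ≥ (1 − f_p) μ_k(p)`,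
`μ_{k+1}(q) ≥ f_p μ_k(p)`), so `E[lateTouchFr_L] ≳ 2η² · r(σ) · E[mass-together on the late window]` with the prompt
re-touch multiplicity `r(σ) ≍ σ³ > 0` (N-uniform at fixed `σ`): besides the pure pair-transience tail (contacts long
after the LAST parting, `≍ σ⁶ (n_N(1 − 1/L))^{−1/2} → 0`), `LateTouchRareAt` — and likewise `LateMergesRareAt`, whose
prompt re-merges carry the extra factor `f'_p(1−f'_q) + f'_q(1−f'_p)` — contains `r(σ) ×` the crux's own coincidence
functional on the shifted window `[t − Δ_N, t − Δ_N/L]`. It is therefore provable only jointly with the one-path inputs,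
through the renewal inequality of card `coalescing-influence-tracers`
(`K_R ≤ [LateTouch_{after last parting} + r(σ)(a' + slot terms)]/(1 − r(σ))`, bootstrap over depths with `2r/(1−r) < 1`);
a "contacts after the last parting" functional is NOT a function of the one-tracer marginals `μ = a/3` (it needs
two-tracer path weights, i.e. products of `shareFrac` along the history) and is not defined here.

Nothing is assumed: `LateTouchRareAt`/`LateTouchRare` are predicates, consumed only as explicit hypotheses.
-/

namespace Summit.AtomisticToContinuum.HydrodynamicLimit.Theorems.DiffuseBackwardInfluenceShare

open scoped BigOperators Topology ENNReal InnerProductSpace Classical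
open Filter Set MeasureTheory
open Literature.Analysis.FluidPDE (Config HardSphereFlow collidePair)
open Literature.MathematicalPhysics.KineticTheory (localGibbsLaw hsDiameter)
open Summit.AtomisticToContinuum.HydrodynamicLimit.Theorems.DiffuseBackwardInfluenceNeg

noncomputable section

namespace LateMerges

/-! ## §1 Range facts: `‖unitNormal‖ ≤ 1`, `blockShare ≤ blockMass`, `shareFrac ∈ [0,1]` -/

section Range

variable {σ : ℝ} {N : ℕ}

/-- The realised unit normal has norm `1` if the step reflects a pair at a nonzero separation vector and `0`
otherwise; in all cases `‖unitNormal‖ ≤ 1`. [folklore] -/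
theorem norm_unitNormal_le_one (y : Cfg N) (k : ℕ) : ‖unitNormal σ N y k‖ ≤ 1 := by
  unfold unitNormal
  by_cases h : normalAt σ N y k = 0
  · rw [h, smul_zero, norm_zero]
    exact zero_le_one
  · exact (norm_smul_inv_norm h).le

/-- Bessel / Cauchy–Schwarz: along a vector of norm `≤ 1` the share of a block is at most its mass,
`Σ_a ⟨ω, M_ik e_a⟩² ≤ Σ_a ‖M_ik e_a‖²`. [folklore] -/
theorem blockShare_le_blockMass (y : Cfg N) (n : ℕ) (i k : Fin (N + 1)) {ω : V3} (hω : ‖ω‖ ≤ 1) :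
    blockShare σ N y n i k ω ≤ blockMass σ N y n i k := by
  unfold blockShare blockMass
  refine Finset.sum_le_sum fun a _ => ?_
  have h1 : |⟪ω, blockCol σ N y n i k a⟫_ℝ| ≤ ‖blockCol σ N y n i k a‖ :=
    (abs_real_inner_le_norm _ _).trans (mul_le_of_le_one_left (norm_nonneg _) hω)
  rw [← sq_abs]
  exact pow_le_pow_left₀ (abs_nonneg _) h1 2

/-- The share along the realised unit normal is at most the mass. [folklore] -/
theorem blockShare_unitNormal_le_blockMass (y : Cfg N) (n : ℕ) (i k : Fin (N + 1)) (k' : ℕ) :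
    blockShare σ N y n i k (unitNormal σ N y k') ≤ blockMass σ N y n i k :=
  blockShare_le_blockMass y n i k (norm_unitNormal_le_one y k')

/-- Handed-over fractions are nonnegative (whatever the vector). [folklore] -/
theorem shareFrac_nonneg (y : Cfg N) (n : ℕ) (i k : Fin (N + 1)) (ω : V3) : 0 ≤ shareFrac σ N y n i k ω :=
  div_nonneg (blockShare_nonneg σ N y n i k ω) (blockMass_nonneg σ N y n i k)

/-- Handed-over fractions along a vector of norm `≤ 1` are at most `1` (junk `0` for a massless block). [folklore] -/
theorem shareFrac_le_one (y : Cfg N) (n : ℕ) (i k : Fin (N + 1)) {ω : V3} (hω : ‖ω‖ ≤ 1) :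
    shareFrac σ N y n i k ω ≤ 1 :=
  div_le_one_of_le₀ (blockShare_le_blockMass y n i k hω) (blockMass_nonneg σ N y n i k)

/-- The fractions entering `mergeAt` lie in `[0, 1]`. [folklore] -/
theorem shareFrac_unitNormal_mem_Icc (y : Cfg N) (n : ℕ) (i k : Fin (N + 1)) (k' : ℕ) :
    shareFrac σ N y n i k (unitNormal σ N y k') ∈ Icc (0 : ℝ) 1 :=
  ⟨shareFrac_nonneg y n i k _, shareFrac_le_one y n i k (norm_unitNormal_le_one y k')⟩

/-- The merge probability of two independent jumps with probabilities `p, q ∈ [0,1]` lies in `[0,1]`: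
`0 ≤ p(1−q) + q(1−p) ≤ 1` (`1 − (p(1−q) + q(1−p)) = (1−p)(1−q) + pq`). [folklore] -/
theorem mergeProb_mem_Icc {p q : ℝ} (hp : p ∈ Icc (0 : ℝ) 1) (hq : q ∈ Icc (0 : ℝ) 1) :
    p * (1 - q) + q * (1 - p) ∈ Icc (0 : ℝ) 1 := by
  obtain ⟨hp0, hp1⟩ := hp
  obtain ⟨hq0, hq1⟩ := hq
  refine ⟨add_nonneg (mul_nonneg hp0 (by linarith)) (mul_nonneg hq0 (by linarith)), ?_⟩
  have hkey : 1 - (p * (1 - q) + q * (1 - p)) = (1 - p) * (1 - q) + p * q := by ring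
  nlinarith [mul_nonneg (sub_nonneg.2 hp1) (sub_nonneg.2 hq1), mul_nonneg hp0 hq0]

/-- Conversely, at an `η`-NON-DEGENERATE pair of jumps (`p, q ∈ [η, 1 − η]`) the merge probability is at least
`2η(1−η)` (`p(1−q) + q(1−p) − 2η(1−η) = (p−η)(1−η−q) + (q−η)(1−η−p)` for the bilinear form): on non-degenerate
collisions merges and contacts are comparable, so the reduction below loses only degenerate contacts. [folklore] -/
theorem mergeProb_ge_of_nondeg {η p q : ℝ} (hp : p ∈ Icc η (1 - η)) (hq : q ∈ Icc η (1 - η)) :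
    2 * η * (1 - η) ≤ p * (1 - q) + q * (1 - p) := by
  obtain ⟨hp0, hp1⟩ := hp
  obtain ⟨hq0, hq1⟩ := hq
  have hkey : p * (1 - q) + q * (1 - p) - 2 * η * (1 - η) = (p - η) * (1 - η - q) + (q - η) * (1 - η - p) := by
    ring
  nlinarith [mul_nonneg (sub_nonneg.2 hp0) (sub_nonneg.2 hq1), mul_nonneg (sub_nonneg.2 hq0) (sub_nonneg.2 hp1)]

end Range

/-! ## §2 The two-tracer CONTACT mass, the kinship, and the domination `mergeAt ≤ touchAt` -/

section Contact

variable (σ : ℝ) (N : ℕ)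

/-- KINSHIP of particles `p, q` after `n` fold steps: `K_pq(n) = Σ_src a_{p,src}(n) a_{q,src}(n)`
(`= 9 Σ_src μ_src(p) μ_src(q)`; `K_pp = Σ_src a_{p,src}²` is the row participation). -/
def kinship (y : Cfg N) (n : ℕ) (p q : Fin (N + 1)) : ℝ :=
  ∑ src : Fin (N + 1), blockMass σ N y n p src * blockMass σ N y n q src

/-- CONTACT mass of the two tracers of source `src` at fold step `k`: `2 μ(p) μ(q)` at the reflected pair `(p, q)`
(the probability that the two conditionally independent tracers of `src` sit on the two endpoints of collision `k`
just before it; `0` if the step reflects nothing). `mergeAt` is this times the merge probability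
`f_p(1−f_q) + f_q(1−f_p)`. -/
def touchAt (y : Cfg N) (src : Fin (N + 1)) (k : ℕ) : ℝ :=
  if h : (pairsAt σ N y k).Nonempty then
    2 * (blockMass σ N y k h.some.1 src / 3) * (blockMass σ N y k h.some.2 src / 3)
  else 0

/-- LATE CONTACT MASS: source-averaged contact mass of the two tracers during the last `1/L` of the window (fold
steps with index in `[colls((1 − 1/L)Δ), colls Δ)`) — the expected number of host–host contacts of the two tracers
of a uniform source in the late window. `lateMergeFr` with `mergeAt` replaced by `touchAt`. -/
def lateTouchFr (y : Cfg N) (Δ : ℝ) (L : ℕ) : ℝ :=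
  ((N + 1 : ℕ) : ℝ)⁻¹ * ∑ src : Fin (N + 1),
    ∑ k ∈ Finset.Ico (colls σ N y ((1 - 1 / (L : ℝ)) * Δ)) (colls σ N y Δ), touchAt σ N y src k

variable {σ N}

/-- Contact masses vanish at steps that reflect nothing. [folklore] -/
theorem touchAt_of_not_nonempty {y : Cfg N} {k : ℕ} (h : ¬ (pairsAt σ N y k).Nonempty) (src : Fin (N + 1)) :
    touchAt σ N y src k = 0 := by
  unfold touchAt
  rw [dif_neg h]

/-- Contact masses at a reflecting step, unfolded. [folklore] -/
theorem touchAt_of_nonempty {y : Cfg N} {k : ℕ} (h : (pairsAt σ N y k).Nonempty) (src : Fin (N + 1)) :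
    touchAt σ N y src k = 2 * (blockMass σ N y k h.some.1 src / 3) * (blockMass σ N y k h.some.2 src / 3) := by
  unfold touchAt
  rw [dif_pos h]

/-- Contact masses are nonnegative. [folklore] -/
theorem touchAt_nonneg (y : Cfg N) (src : Fin (N + 1)) (k : ℕ) : 0 ≤ touchAt σ N y src k := by
  by_cases h : (pairsAt σ N y k).Nonempty
  · rw [touchAt_of_nonempty h]
    have h1 := blockMass_nonneg σ N y k h.some.1 src
    have h2 := blockMass_nonneg σ N y k h.some.2 src
    positivity
  · rw [touchAt_of_not_nonempty h]

/-- KINSHIP DICTIONARY: summed over the sources, the contact mass of fold step `k` is `(2/9) K_{pq}(k)` at the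
reflected pair. [folklore] -/
theorem sum_touchAt_eq_kinship {y : Cfg N} {k : ℕ} (h : (pairsAt σ N y k).Nonempty) :
    ∑ src : Fin (N + 1), touchAt σ N y src k = 2 / 9 * kinship σ N y k h.some.1 h.some.2 := by
  unfold kinship
  rw [Finset.mul_sum]
  refine Finset.sum_congr rfl fun src _ => ?_
  rw [touchAt_of_nonempty h]
  ring

/-- **Merge masses are nonnegative** (the fractions lie in `[0,1]`): the stub's integrand `ofReal (lateMergeFr …)`
truncates nothing. [folklore] -/
theorem mergeAt_nonneg (y : Cfg N) (src : Fin (N + 1)) (k : ℕ) : 0 ≤ mergeAt σ N y src k := by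
  unfold mergeAt
  by_cases h : (pairsAt σ N y k).Nonempty
  · rw [dif_pos h]
    have h1 := blockMass_nonneg σ N y k h.some.1 src
    have h2 := blockMass_nonneg σ N y k h.some.2 src
    have hm := (mergeProb_mem_Icc (shareFrac_unitNormal_mem_Icc (σ := σ) y k h.some.1 src k)
      (shareFrac_unitNormal_mem_Icc (σ := σ) y k h.some.2 src k)).1
    exact mul_nonneg (by positivity) hm
  · rw [dif_neg h]

/-- **Merges are contacts: `mergeAt ≤ touchAt`** (merge probability `≤ 1`). [folklore] -/
theorem mergeAt_le_touchAt (y : Cfg N) (src : Fin (N + 1)) (k : ℕ) : mergeAt σ N y src k ≤ touchAt σ N y src k := by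
  unfold mergeAt
  by_cases h : (pairsAt σ N y k).Nonempty
  · rw [dif_pos h, touchAt_of_nonempty h]
    have h1 := blockMass_nonneg σ N y k h.some.1 src
    have h2 := blockMass_nonneg σ N y k h.some.2 src
    have hm := (mergeProb_mem_Icc (shareFrac_unitNormal_mem_Icc (σ := σ) y k h.some.1 src k)
      (shareFrac_unitNormal_mem_Icc (σ := σ) y k h.some.2 src k)).2
    exact mul_le_of_le_one_right (by positivity) hm
  · rw [dif_neg h, touchAt_of_not_nonempty h]

/-- Conversely `2η(1−η) · touchAt ≤ mergeAt` at a step whose two fractions for the source are `η`-non-degenerate: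
the reduction to contacts loses only share-degenerate contacts. [folklore] -/
theorem touchAt_le_mergeAt_of_nondeg {y : Cfg N} {k : ℕ} (h : (pairsAt σ N y k).Nonempty) (src : Fin (N + 1)) {η : ℝ}
    (hp : shareFrac σ N y k h.some.1 src (unitNormal σ N y k) ∈ Icc η (1 - η))
    (hq : shareFrac σ N y k h.some.2 src (unitNormal σ N y k) ∈ Icc η (1 - η)) :
    2 * η * (1 - η) * touchAt σ N y src k ≤ mergeAt σ N y src k := by
  unfold mergeAt
  rw [dif_pos h, touchAt_of_nonempty h]
  have h1 := blockMass_nonneg σ N y k h.some.1 src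
  have h2 := blockMass_nonneg σ N y k h.some.2 src
  have hm := mergeProb_ge_of_nondeg hp hq
  have hc : (0 : ℝ) ≤ 2 * (blockMass σ N y k h.some.1 src / 3) * (blockMass σ N y k h.some.2 src / 3) := by
    positivity
  calc 2 * η * (1 - η) * (2 * (blockMass σ N y k h.some.1 src / 3) * (blockMass σ N y k h.some.2 src / 3))
      = 2 * (blockMass σ N y k h.some.1 src / 3) * (blockMass σ N y k h.some.2 src / 3) * (2 * η * (1 - η)) := by
        ring
    _ ≤ 2 * (blockMass σ N y k h.some.1 src / 3) * (blockMass σ N y k h.some.2 src / 3) *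
          (shareFrac σ N y k h.some.1 src (unitNormal σ N y k) *
              (1 - shareFrac σ N y k h.some.2 src (unitNormal σ N y k)) +
            shareFrac σ N y k h.some.2 src (unitNormal σ N y k) *
              (1 - shareFrac σ N y k h.some.1 src (unitNormal σ N y k))) :=
        mul_le_mul_of_nonneg_left hm hc

/-- Late merge masses are nonnegative. [folklore] -/
theorem lateMergeFr_nonneg (y : Cfg N) (Δ : ℝ) (L : ℕ) : 0 ≤ lateMergeFr σ N y Δ L := by
  unfold lateMergeFr
  refine mul_nonneg (inv_nonneg.2 (by positivity)) ?_
  exact Finset.sum_nonneg fun src _ => Finset.sum_nonneg fun k _ => mergeAt_nonneg y src k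

/-- Late contact masses are nonnegative. [folklore] -/
theorem lateTouchFr_nonneg (y : Cfg N) (Δ : ℝ) (L : ℕ) : 0 ≤ lateTouchFr σ N y Δ L := by
  unfold lateTouchFr
  refine mul_nonneg (inv_nonneg.2 (by positivity)) ?_
  exact Finset.sum_nonneg fun src _ => Finset.sum_nonneg fun k _ => touchAt_nonneg y src k

/-- **THE POINTWISE REDUCTION: `lateMergeFr ≤ lateTouchFr`** for every configuration, window and `L`. [folklore] -/
theorem lateMergeFr_le_lateTouchFr (y : Cfg N) (Δ : ℝ) (L : ℕ) : lateMergeFr σ N y Δ L ≤ lateTouchFr σ N y Δ L := by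
  unfold lateMergeFr lateTouchFr
  refine mul_le_mul_of_nonneg_left ?_ (inv_nonneg.2 (by positivity))
  exact Finset.sum_le_sum fun src _ => Finset.sum_le_sum fun k _ => mergeAt_le_touchAt y src k

/-- The late contact mass through the kinship of the colliding pairs:
`lateTouchFr = (N+1)⁻¹ Σ_{late k} (2/9) K_{p_k q_k}(k)` (non-reflecting steps contribute `0`). [folklore] -/
theorem lateTouchFr_eq_sum_kinship (y : Cfg N) (Δ : ℝ) (L : ℕ) :
    lateTouchFr σ N y Δ L = ((N + 1 : ℕ) : ℝ)⁻¹ *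
      ∑ k ∈ Finset.Ico (colls σ N y ((1 - 1 / (L : ℝ)) * Δ)) (colls σ N y Δ),
        if h : (pairsAt σ N y k).Nonempty then 2 / 9 * kinship σ N y k h.some.1 h.some.2 else 0 := by
  unfold lateTouchFr
  rw [Finset.sum_comm]
  congr 1
  refine Finset.sum_congr rfl fun k _ => ?_
  by_cases h : (pairsAt σ N y k).Nonempty
  · rw [dif_pos h, sum_touchAt_eq_kinship h]
  · rw [dif_neg h]
    exact Finset.sum_eq_zero fun src _ => touchAt_of_not_nonempty h src

/-! ### Scale of the contact mass under the row budget (neighbour stub `stub_rowBudgetN`, here a hypothesis) -/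

/-- Under the row budget every block mass is at most `3`. [folklore] -/
theorem blockMass_le_three (hRB : RowBudgetN σ) (y : Cfg N) (n : ℕ) (i k : Fin (N + 1)) :
    blockMass σ N y n i k ≤ 3 := by
  rw [← hRB N y n i]
  exact Finset.single_le_sum (f := fun k => blockMass σ N y n i k) (fun k _ => blockMass_nonneg σ N y n i k)
    (Finset.mem_univ k)

/-- Under the row budget the kinship of any two particles is at most `9`. [folklore] -/
theorem kinship_le_nine (hRB : RowBudgetN σ) (y : Cfg N) (n : ℕ) (p q : Fin (N + 1)) : kinship σ N y n p q ≤ 9 := by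
  unfold kinship
  calc ∑ src : Fin (N + 1), blockMass σ N y n p src * blockMass σ N y n q src
      ≤ ∑ src : Fin (N + 1), blockMass σ N y n p src * 3 :=
        Finset.sum_le_sum fun src _ =>
          mul_le_mul_of_nonneg_left (blockMass_le_three hRB y n q src) (blockMass_nonneg σ N y n p src)
    _ = 3 * 3 := by rw [← Finset.sum_mul, hRB N y n p]
    _ = 9 := by norm_num

/-- Under the row budget one fold step carries total contact mass `≤ 2` (so `lateTouchFr ≤ 2·#(late steps)/(N+1)`,
of order `n_N / L` collisions per particle: neither trivially small nor bounded). [folklore] -/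
theorem sum_touchAt_le_two (hRB : RowBudgetN σ) (y : Cfg N) (k : ℕ) : ∑ src : Fin (N + 1), touchAt σ N y src k ≤ 2 := by
  by_cases h : (pairsAt σ N y k).Nonempty
  · rw [sum_touchAt_eq_kinship h]
    have := kinship_le_nine hRB y k h.some.1 h.some.2
    linarith
  · rw [Finset.sum_eq_zero fun src _ => touchAt_of_not_nonempty h src]
    norm_num

/-- Under the row budget, `lateTouchFr ≤ 2 · #(late fold steps)/(N+1)`. [folklore] -/
theorem lateTouchFr_le_card (hRB : RowBudgetN σ) (y : Cfg N) (Δ : ℝ) (L : ℕ) :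
    lateTouchFr σ N y Δ L ≤ 2 * ((Finset.Ico (colls σ N y ((1 - 1 / (L : ℝ)) * Δ)) (colls σ N y Δ)).card : ℝ) /
      ((N + 1 : ℕ) : ℝ) := by
  set I : Finset ℕ := Finset.Ico (colls σ N y ((1 - 1 / (L : ℝ)) * Δ)) (colls σ N y Δ) with hI
  have hN : (0 : ℝ) ≤ ((N + 1 : ℕ) : ℝ)⁻¹ := inv_nonneg.2 (by positivity)
  have hsum : ∑ src : Fin (N + 1), ∑ k ∈ I, touchAt σ N y src k ≤ 2 * (I.card : ℝ) := by
    rw [Finset.sum_comm]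
    calc ∑ k ∈ I, ∑ src : Fin (N + 1), touchAt σ N y src k ≤ ∑ _k ∈ I, (2 : ℝ) :=
          Finset.sum_le_sum fun k _ => sum_touchAt_le_two hRB y k
      _ = 2 * (I.card : ℝ) := by rw [Finset.sum_const, nsmul_eq_mul, mul_comm]
  unfold lateTouchFr
  calc ((N + 1 : ℕ) : ℝ)⁻¹ * ∑ src : Fin (N + 1), ∑ k ∈ I, touchAt σ N y src k
      ≤ ((N + 1 : ℕ) : ℝ)⁻¹ * (2 * (I.card : ℝ)) := mul_le_mul_of_nonneg_left hsum hN
    _ = 2 * (I.card : ℝ) / ((N + 1 : ℕ) : ℝ) := by rw [div_eq_inv_mul]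

end Contact

/-! ## §3 The named two-body estimate and the reduction -/

/-- LATE CONTACTS ARE RARE (the named two-body estimate, at fixed `(σ, profiles, flow family)`): for every
admissible window, `t > 0` and `ε > 0` there is `L ≥ 1` such that eventually the expected number of host–host
contacts of the two influence tracers of a uniform source during the last `1/L` of the window, along the
local-Gibbs-EVOLVED law, is `≤ ε`. `LateMergesRareAt` with `lateMergeFr` replaced by the share-free, normal-free
`lateTouchFr` (pair transience in `d = 3`; the `LateTouch → 0` input of card `coalescing-influence-tracers`; named
collective failure: confinement of both tracers to `O(1)` hosts, kill criterion k3 of the route). -/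
def LateTouchRareAt (σ : ℝ) (a₀ θ₀ : T3 → ℝ) (u₀ : T3 → V3) (Φ : (N : ℕ) → Flow σ N) : Prop :=
  ∀ Δ : ℕ → ℝ, (∀ N, 0 < Δ N) → Tendsto Δ atTop (𝓝 0) →
    Tendsto (fun N : ℕ => Δ N * ((N + 1 : ℕ) : ℝ) ^ ((1 : ℝ) / 3)) atTop atTop →
    ∀ t : ℝ, 0 < t → ∀ ε : ℝ, 0 < ε → ∃ L : ℕ, 1 ≤ L ∧
      ∀ᶠ N : ℕ in atTop,
        ∫⁻ z, ENNReal.ofReal (lateTouchFr σ N ((Φ N).flow (t - Δ N) z) (Δ N) L)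
            ∂(localGibbsLaw σ a₀ u₀ θ₀ N (Φ N)) ≤ ENNReal.ofReal ε

/-- LATE CONTACTS ARE RARE, quantified as the stub: for continuous positive profiles there is `σ₀ > 0` such that
`LateTouchRareAt σ a₀ θ₀ u₀ Φ` for all `σ ∈ (0, σ₀)` and all flow families. THE statement `stub_lateMergesRare` is
blocked on. -/
def LateTouchRare : Prop :=
  ∀ (a₀ θ₀ : T3 → ℝ) (u₀ : T3 → V3), Continuous a₀ → Continuous θ₀ → Continuous u₀ →
    (∀ x, 0 < a₀ x) → (∀ x, 0 < θ₀ x) → ∃ σ₀ : ℝ, 0 < σ₀ ∧ ∀ σ : ℝ, 0 < σ → σ < σ₀ →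
    ∀ Φ : (N : ℕ) → Flow σ N, LateTouchRareAt σ a₀ θ₀ u₀ Φ

/-- Monotonicity of the stub's integral in the integrand: the late-merge integral is dominated by the
late-contact integral, for every law. [folklore] -/
theorem lintegral_lateMergeFr_le {σ : ℝ} {N : ℕ} (μ : Measure (Cfg N)) (T : Cfg N → Cfg N) (Δ : ℝ) (L : ℕ) :
    ∫⁻ z, ENNReal.ofReal (lateMergeFr σ N (T z) Δ L) ∂μ ≤ ∫⁻ z, ENNReal.ofReal (lateTouchFr σ N (T z) Δ L) ∂μ :=
  lintegral_mono fun z => ENNReal.ofReal_le_ofReal (lateMergeFr_le_lateTouchFr (T z) Δ L)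

end LateMerges

/-- **REGISTERED SUB-GOAL — the reduction of the late-merge stub to the named two-body estimate:** at every fixed
`(σ, profiles, flow family)`, if late host–host contacts of the two tracers are rare then late merges are rare
(`mergeAt ≤ touchAt` pointwise, monotonicity of the outer integral; no row budget, no measurability). [folklore] -/
theorem lateMergesRare_of_lateTouchRare : ∀ (σ : ℝ) (a₀ θ₀ : T3 → ℝ) (u₀ : T3 → V3) (Φ : (N : ℕ) → Flow σ N), LateMerges.LateTouchRareAt σ a₀ θ₀ u₀ Φ → LateMergesRareAt σ a₀ θ₀ u₀ Φ := by
  intro σ a₀ θ₀ u₀ Φ h Δ hΔp hΔ0 hΔg t ht ε hε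
  obtain ⟨L, hL1, hL⟩ := h Δ hΔp hΔ0 hΔg t ht ε hε
  refine ⟨L, hL1, hL.mono fun N hN => ?_⟩
  exact (LateMerges.lintegral_lateMergeFr_le _ _ _ _).trans hN

/-- **The stub from the named estimate:** `LateTouchRare` implies the registered statement of `stub_lateMergesRare`
verbatim (same `σ₀`). [folklore] -/
theorem lateMergesRareAll_of_lateTouchRare (h : LateMerges.LateTouchRare) :
    ∀ (a₀ θ₀ : T3 → ℝ) (u₀ : T3 → V3), Continuous a₀ → Continuous θ₀ → Continuous u₀ → (∀ x, 0 < a₀ x) →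
      (∀ x, 0 < θ₀ x) → ∃ σ₀ : ℝ, 0 < σ₀ ∧ ∀ σ : ℝ, 0 < σ → σ < σ₀ →
      ∀ Φ : (N : ℕ) → Flow σ N, LateMergesRareAt σ a₀ θ₀ u₀ Φ := by
  intro a₀ θ₀ u₀ ha hθ hu ha0 hθ0
  obtain ⟨σ₀, hσ₀, H⟩ := h a₀ θ₀ u₀ ha hθ hu ha0 hθ0
  exact ⟨σ₀, hσ₀, fun σ hσ hσlt Φ => lateMergesRare_of_lateTouchRare σ a₀ θ₀ u₀ Φ (H σ hσ hσlt Φ)⟩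

end

end Summit.AtomisticToContinuum.HydrodynamicLimit.Theorems.DiffuseBackwardInfluenceShare
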